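import Summits.QuantumFields.YangMills.Theses.ConvexGribovBody
import Summits.QuantumFields.YangMills.Theorems.ConvexGribovBodyStrongCouplingShapeTorusBound

/-!
# `StrongCouplingShape`: volume-uniform exponential clustering at strong coupling

Closes item stmt-QuantumFields-8783 of route `ConvexGribovBody`: for every compact group `G`
with a continuous matrix representation `r` (in particular every compact simple Lie group with
a lattice representation) there is `β₁ = betaOne 4 r.ρ / 4 > 0` such that for `0 ≤ β < β₁`
all pairs of gauge-invariant local observables `A, B` cluster in Euclidean time on every torus
`(2S+1)⁴`, `n ≤ S`, with `|⟨A · τₙB⟩ - ⟨A⟩⟨B⟩| ≤ C(A, B) e^{-(log 2) n}` — the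
`latticeConnectedCorr` shape of `HasLatticeMassGap`, uniformly in the volume.

The tree's `osterwalder_seiler_torusClustering_holds` has its volume threshold inside the
quantifier over the separation and cannot deliver this uniformity; instead the
Osterwalder–Seiler analyticity mechanism (Ann. Phys. 110 (1978), Thm. 3.5) is run directly on
the torus plaquette system (`norm_torusTruncated_le` of the support file `…TorusBound`): the
truncated torus expectation is holomorphic and uniformly bounded on the strong-coupling disc,
vanishes at `β = 0` to the order `n - 2r` of the shortest chain of plaquettes joining the two
supports around the torus, and the Schwarz lemma gives the exponential bound. This file only
transcribes that bound into the `wilsonMeasure`/`torusLift`/`configShift` rendering of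
`latticeConnectedCorr` (`wilsonExpectation_toTorusObservable_eq_re_expect`, translation
invariance of the torus Wilson state).
-/

noncomputable section

open MeasureTheory Filter Topology Finset
open Literature.MathematicalPhysics.QuantumFieldTheory
open Literature.MathematicalPhysics.QuantumLattice (configShift toTorusObservable IsCylinder)

namespace Summit.QuantumFields.YangMills.Theorems

open StrongCouplingShape

/-- **Volume-uniform clustering of torus time-correlations at strong coupling.** For a
continuous matrix representation `ρ` of the compact group `G`, gauge-invariant local
observables `A`, `B` bounded by `C_A`, `C_B` whose supports have time coordinates bounded by
`r`, real `0 ≤ β ≤ betaOne 4 ρ / 4`, and `n ≤ S`: on the torus of side `2S+1`,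
`|⟨A · τₙ B⟩ - ⟨A⟩⟨B⟩| ≤ 2 C_A C_B (2e^{1/2})^{2q} 2^{-(n - 2r)}` with
`q = (|supp A| + |supp B|) · 2⁴ · 4²`. [folklore] -/
theorem abs_latticeConnectedCorr_le {G : Type} [Group G] [TopologicalSpace G]
    [IsTopologicalGroup G] [CompactSpace G] [MeasurableSpace G] [BorelSpace G] {N : ℕ}
    {ρ : G →* Matrix (Fin N) (Fin N) ℂ} (hρ : Continuous ρ) (A B : YMSpecies G) {C_A C_B : ℝ}
    (hA : ∀ U, |A.F U| ≤ C_A) (hB : ∀ U, |B.F U| ≤ C_B) {r : ℕ}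
    (hrA : ∀ e ∈ A.supp, (e.1 0).natAbs ≤ r) (hrB : ∀ e ∈ B.supp, (e.1 0).natAbs ≤ r)
    {β : ℝ} (hβ0 : 0 ≤ β) (hβ : β ≤ betaOne 4 ρ / 4) (S n : ℕ) (hn : n ≤ S) :
    |latticeConnectedCorr ρ β (2 * S + 1) A.F B.F n| ≤
      2 * C_A * C_B * (2 * Real.exp (1 / 2)) ^ (2 * ((A.supp.card + B.supp.card) *
        (2 ^ 4 * (4 * 4)))) * (1 / 2) ^ (n - 2 * r) := by
  set L := 2 * S + 1 with hL
  set v : Literature.Probability.LatticeModels.Site 4 := -Pi.single 0 (n : ℤ) with hv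
  have hv0 : v 0 = -(n : ℤ) := by simp [hv]
  -- the complexified observables
  set F₁ : ZdGaugeConfig 4 G → ℂ := fun U => ((A.F U : ℝ) : ℂ) with hF₁
  set F₂ : ZdGaugeConfig 4 G → ℂ := fun U => ((B.F (configShift v U) : ℝ) : ℂ) with hF₂
  have hBvm : Measurable fun U : ZdGaugeConfig 4 G => B.F (configShift v U) :=
    B.measurable.comp (configShift v).measurable
  have h₁m : Measurable F₁ := Complex.measurable_ofReal.comp A.measurable
  have h₂m : Measurable F₂ := Complex.measurable_ofReal.comp hBvm
  have h₁b : ∀ U, ‖F₁ U‖ ≤ C_A := fun U => by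
    simp only [hF₁, Complex.norm_real, Real.norm_eq_abs]; exact hA U
  have h₂b : ∀ U, ‖F₂ U‖ ≤ C_B := fun U => by
    simp only [hF₂, Complex.norm_real, Real.norm_eq_abs]; exact hB _
  have hBv : IsCylinder (B.F ∘ configShift v) (B.supp.image fun e => (e.1 - v, e.2)) :=
    IsCylinder.comp_configShift B.isCylinder v
  have h₁B : DependsOn F₁ (A.supp : Set (ZdEdge 4)) := fun U V h => by
    simp only [hF₁, A.isCylinder h]
  have h₂B : DependsOn F₂ ((B.supp.image fun e => (e.1 - v, e.2) : Finset (ZdEdge 4)) :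
      Set (ZdEdge 4)) := fun U V h => by
    have e := hBv h
    simp only [Function.comp_apply] at e
    simp only [hF₂, e]
  have hβc : ‖(β : ℂ)‖ ≤ betaOne 4 ρ / 4 := by
    rw [Complex.norm_real, Real.norm_eq_abs, abs_of_nonneg hβ0]; exact hβ
  have key := norm_torusTruncated_le (G := G) hρ S n hn 0 v hv0 h₁m h₂m h₁b h₂b h₁B h₂B hrA hrB
    hβc
  -- the three torus Wilson expectations as real parts of torus-system expectations
  have hABm : Measurable fun U : ZdGaugeConfig 4 G => A.F U * B.F (configShift v U) :=
    A.measurable.mul hBvm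
  have hC_A : 0 ≤ C_A := (abs_nonneg _).trans (hA fun _ => 1)
  have hABb : ∀ U : ZdGaugeConfig 4 G, |A.F U * B.F (configShift v U)| ≤ C_A * C_B := fun U => by
    rw [abs_mul]; exact mul_le_mul (hA U) (hB _) (abs_nonneg _) hC_A
  have e12 := wilsonExpectation_toTorusObservable_eq_re_expect (d := 4) (L := L) ρ hρ β hABm hABb
  have e1 := wilsonExpectation_toTorusObservable_eq_re_expect (d := 4) (L := L) ρ hρ β
    A.measurable hA
  have e2 := wilsonExpectation_toTorusObservable_eq_re_expect (d := 4) (L := L) ρ hρ β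
    (F := B.F ∘ configShift v) hBvm (fun U => hB _)
  -- translation invariance for `⟨B⟩`
  have e2' : wilsonExpectation (L := L) ρ β (toTorusObservable L B.F) =
      wilsonExpectation (L := L) ρ β (toTorusObservable L (B.F ∘ configShift v)) := by
    rw [toTorusObservable_comp_configShift, wilsonExpectation_comp_torusConfigShift]
  have hcorr : latticeConnectedCorr ρ β L A.F B.F n =
      wilsonExpectation (L := L) ρ β (toTorusObservable L fun U => A.F U * B.F (configShift v U)) -
        wilsonExpectation (L := L) ρ β (toTorusObservable L A.F) *
          wilsonExpectation (L := L) ρ β (toTorusObservable L (B.F ∘ configShift v)) := by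
    rw [← e2']
    rfl
  -- identification of the complex observables
  have i12 : (fun U : ZdGaugeConfig 4 G =>
      (((A.F (U ∘ torusRed L) * B.F (configShift v (U ∘ torusRed L)) : ℝ) : ℂ))) =
      fun U => F₁ (U ∘ torusRed L) * F₂ (U ∘ torusRed L) := by
    funext U; simp only [hF₁, hF₂]; push_cast; rfl
  have r1 : ((torusSystem ρ L).expect (fun U => F₁ (U ∘ torusRed L)) (torusGenuine 4 L) β).im =
      0 := expect_ofReal_im (S := torusSystem ρ L) (fun U => A.F (U ∘ torusRed L)) _ β
  have r2 : ((torusSystem ρ L).expect (fun U => F₂ (U ∘ torusRed L)) (torusGenuine 4 L) β).im =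
      0 :=
    expect_ofReal_im (S := torusSystem ρ L) (fun U => B.F (configShift v (U ∘ torusRed L))) _ β
  have hval : latticeConnectedCorr ρ β L A.F B.F n =
      ((torusSystem ρ L).expect (fun U => F₁ (U ∘ torusRed L) * F₂ (U ∘ torusRed L))
          (torusGenuine 4 L) β -
        (torusSystem ρ L).expect (fun U => F₁ (U ∘ torusRed L)) (torusGenuine 4 L) β *
          (torusSystem ρ L).expect (fun U => F₂ (U ∘ torusRed L)) (torusGenuine 4 L) β).re := by
    rw [hcorr, e12, e1, e2, i12, Complex.sub_re, Complex.mul_re, r1, r2, mul_zero, sub_zero]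
    rfl
  rw [hval]
  exact (Complex.abs_re_le_norm _).trans key

/-- **`StrongCouplingShape` (item stmt-QuantumFields-8783, route ConvexGribovBody): the
volume-uniform strong-coupling clustering in the `latticeConnectedCorr` shape.** For every
compact simple Lie group `G` and lattice representation `r` there is `β₁ > 0`
(`betaOne 4 r.ρ / 4`) such that for `0 ≤ β < β₁`, with `m = log 2` and `S₁ = 0`, every pair of
gauge-invariant local observables `A, B` has a constant `C` with
`|latticeConnectedCorr r.ρ β (2S+1) A.F B.F n| ≤ C e^{-m n}` for all `S` and all `n ≤ S`
(Osterwalder–Seiler 1978, Thm. 3.5, by the analyticity mechanism on the torus). [folklore] -/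
theorem strongCouplingShape_proof :
    Summit.QuantumFields.YangMills.Theses.ConvexGribovBody.StrongCouplingShape := by
  intro G _ _ _ _ _ _ _ r
  have hb : 0 < betaOne 4 r.ρ := betaOne_pos 4
  refine ⟨betaOne 4 r.ρ / 4, by positivity, fun β hβ0 hβ => ?_⟩
  refine ⟨Real.log 2, Real.log_pos one_lt_two, 0, fun A B => ?_⟩
  obtain ⟨C_A, hA⟩ := A.bounded
  obtain ⟨C_B, hB⟩ := B.bounded
  set r₀ : ℕ := (A.supp ∪ B.supp).sup fun e => (e.1 0).natAbs with hr₀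
  have hrA : ∀ e ∈ A.supp, (e.1 0).natAbs ≤ r₀ := fun e he =>
    Finset.le_sup (f := fun e : ZdEdge 4 => (e.1 0).natAbs) (Finset.mem_union_left _ he)
  have hrB : ∀ e ∈ B.supp, (e.1 0).natAbs ≤ r₀ := fun e he =>
    Finset.le_sup (f := fun e : ZdEdge 4 => (e.1 0).natAbs) (Finset.mem_union_right _ he)
  obtain ⟨K, hK⟩ : ∃ K : ℝ, K = 2 * C_A * C_B * (2 * Real.exp (1 / 2)) ^
      (2 * ((A.supp.card + B.supp.card) * (2 ^ 4 * (4 * 4)))) := ⟨_, rfl⟩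
  have hC_A : 0 ≤ C_A := (abs_nonneg _).trans (hA fun _ => 1)
  have hC_B : 0 ≤ C_B := (abs_nonneg _).trans (hB fun _ => 1)
  have hK0 : 0 ≤ K := by rw [hK]; positivity
  refine ⟨K * 2 ^ (2 * r₀), fun S n _ hn => ?_⟩
  have h := abs_latticeConnectedCorr_le r.continuous A B hA hB hrA hrB hβ0 hβ.le S n hn
  rw [← hK] at h
  -- `(1/2)^(n - 2r₀) ≤ 2^(2r₀) e^{-(log 2) n}`
  have hexp : Real.exp (-(Real.log 2 * n)) = ((2 : ℝ) ^ n)⁻¹ := by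
    rw [Real.exp_neg, mul_comm, Real.exp_nat_mul, Real.exp_log two_pos]
  have hmain : ((1 : ℝ) / 2) ^ (n - 2 * r₀) ≤ 2 ^ (2 * r₀) * ((2 : ℝ) ^ n)⁻¹ := by
    rw [le_mul_inv_iff₀ (by positivity)]
    have h2n : (2 : ℝ) ^ n ≤ 2 ^ (n - 2 * r₀) * 2 ^ (2 * r₀) := by
      rw [← pow_add]; exact pow_le_pow_right₀ one_le_two (by omega)
    have hone : ((1 : ℝ) / 2) ^ (n - 2 * r₀) * 2 ^ (n - 2 * r₀) = 1 := by
      rw [← mul_pow]; norm_num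
    calc ((1 : ℝ) / 2) ^ (n - 2 * r₀) * 2 ^ n
        ≤ ((1 : ℝ) / 2) ^ (n - 2 * r₀) * (2 ^ (n - 2 * r₀) * 2 ^ (2 * r₀)) :=
          mul_le_mul_of_nonneg_left h2n (by positivity)
      _ = 2 ^ (2 * r₀) := by rw [← mul_assoc, hone, one_mul]
  calc |latticeConnectedCorr r.ρ β (2 * S + 1) A.F B.F n| ≤ K * (1 / 2) ^ (n - 2 * r₀) := h
    _ ≤ K * (2 ^ (2 * r₀) * ((2 : ℝ) ^ n)⁻¹) := mul_le_mul_of_nonneg_left hmain hK0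
    _ = K * 2 ^ (2 * r₀) * Real.exp (-(Real.log 2 * n)) := by rw [hexp]; ring

end Summit.QuantumFields.YangMills.Theorems

end
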